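import Summits.QuantumFields.QCD.Theorems.QuarksAsStableActionStableActionBridgeCyclicTraceAP
import Summits.QuantumFields.QCD.Theorems.QuarksAsStableActionStableActionBridgeDiracMatrixAPTrace

/-!
# The `N_f`-flavour thermal lattice-QCD Boltzmann integral as a cyclic kernel trace
(crux `QuarksAsStableAction.StableActionBridge`, item stmt-QuantumFields-9737, line `Sketch`;
registered stub `qcd_boltzmannAP_integral_eq_cyclic_trace_flavour`, the `N_f`-flavour version of
the thermal capstone C `qcd_boltzmannAP_integral_eq_cyclic_trace` of the F3 dictionary)

For `N_f` flavours of `r = 1` Wilson quarks of bare masses `m_f > −1` in the fundamental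
representation of `SU(3)` on the four-torus `(ℤ/N)⁴` (`N ≥ 1`) with the time-ANTIPERIODIC boundary
condition of `QCDTimeReflection.wilsonDiracAP` (Montvay–Münster (4.34): antiperiodic Grassmann time
computes the honest thermal trace), and with the STATEMENT's flavour-diagonal antiperiodic
Wilson–Dirac matrix `D^{AP}(U) = diracMatrixAP U mq = ⊕_f D_W^{AP}[U; m_f]` (Montvay–Münster §5.1),
the Boltzmann integral of lattice QCD over the product Haar measure of the links,

  `Z_AP = ∫ e^{−β S_W(U)} det D^{AP}(U) ∏_e dU_e`,

equals the CYCLIC KERNEL TRACE of `N` projected transfer kernels over the `N_f`-flavour slice Fock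
space: slicing the torus across Euclidean time (spatial links `Us t`, temporal links `gs t` leaving
slice `t`),

  `Z_AP = ∫∫ ∏_t K_β(Us t, (Us (t+1))^{gs t}) · Tr ∏_t T̂_F(Us t) Γ(G_{gs t}) ∏_t dUs_t ∏_t dgs_t`,

with `K_β` the temporal-gauge transfer kernel of the gauge field (`gaugeSliceKernel`, Smit (4.121),
(4.129)), `T̂_F` Smit's `N_f`-flavour fermionic transfer operator (`fermionSliceOp`, Smit (6.91))
and `Γ(G_g)` the Fock-space gauge rotation (`fockGaugeAct`, Smit (4.125)–(4.127)).  NO gauge fixing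
is used: the temporal links, put back as gauge transformations of the next slice and integrated
against Haar, ARE the Gauss-law projections `P̂₀` (Smit (4.137)), so this is the honest
`Z_AP = Tr (𝕋 P̂₀)^N` at kernel level (Lüscher 1977; Osterwalder–Seiler 1978 §2).

Assembly: identical to the one-flavour thermal capstone C (`qcd_boltzmannAP_integral_eq_cyclic_trace`)
and to the `N_f`-flavour periodic one (`qcd_boltzmann_integral_eq_cyclic_supertrace_flavour`): the
Yang–Mills time-slicing theorem `stub_timeSlicing` (the assembling map `(Us, gs) ↦ U` is measure
preserving from the product of the slice Haar measures to the torus Haar measure), the flavour- and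
boundary-condition-blind identification of the Boltzmann weight of the assembled field with the
telescoped cyclic kernel product (`CyclicSupertrace.exp_wilsonAction_timeAssemble`), and the
`N_f`-flavour antiperiodic capstone B `det_diracMatrixAP_eq_trace_fermionSliceOp` (Montvay–Münster's
trace formula for `det D^{AP}(U)`) read through the slicing dictionary; the integrand is continuous
(`continuous_det_diracMatrixAP`: the antiperiodic Wilson–Dirac matrix is entrywise continuous in
the links, flavour block by flavour block), so the integral is transported along the assembling map
(`integral_map`).  Pure theorem file (no definitions).

References: I. Montvay, G. Münster, *Quantum Fields on a Lattice* (CUP 1994), §4.1.3 (4.34) and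
§5.1 [MontvayMunster1994, §4.1.3 (4.34), §5.1]; M. Lüscher, Commun. Math. Phys. 54 (1977) 283
[Luscher1977, pp. 283–292]; K. Osterwalder, E. Seiler, Ann. Phys. 110 (1978) 440
[OsterwalderSeiler1978, §2]; J. Smit, *Introduction to Quantum Fields on a Lattice*
[Smit2023, §4.6 (4.127)–(4.137), §6.5 (6.87)–(6.91)].
-/

noncomputable section

namespace Summit.QuantumFields.QCD.Cruxes.StableActionBridge.Sketch

open MeasureTheory Matrix Literature.MathematicalPhysics.QuantumFieldTheory
  Literature.MathematicalPhysics.QuantumLattice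
open Literature.Probability.LatticeModels (TorusSite)

namespace CyclicTraceAPFlavour

/-- The `N_f`-flavour time-ANTIPERIODIC Wilson–Dirac matrix `D^{AP}(U) = diracMatrixAP U mq`
depends continuously on the gauge field `U` (it is flavour diagonal, its `f`-block the entrywise
continuous one-flavour antiperiodic operator `D_W^{AP}[U; m_f]`; Montvay–Münster (4.112)–(4.115),
(5.5)). [folklore] -/
theorem continuous_diracMatrixAP {Nf N : ℕ} [NeZero N] (mq : Fin Nf → ℝ) :
    Continuous fun U : GaugeConfig 4 N (Matrix.specialUnitaryGroup (Fin 3) ℂ) =>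
      diracMatrixAP U mq := by
  unfold diracMatrixAP
  refine continuous_pi fun i => continuous_pi fun j => ?_
  simp only [Matrix.reindex_apply, Matrix.submatrix_apply, Matrix.of_apply]
  split_ifs
  · exact (CyclicTraceAP.continuous_wilsonDiracAP (fundamentalRep (Fin 3))
      (continuous_fundamentalRep (Fin 3)) _ _).matrix_elem _ _
  · exact continuous_const

/-- `U ↦ det D^{AP}(U)` is continuous on the configuration space `SU(3)^{edges}` (a polynomial in
the link matrix entries). [folklore] -/
theorem continuous_det_diracMatrixAP {Nf N : ℕ} [NeZero N] (mq : Fin Nf → ℝ) :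
    Continuous fun U : GaugeConfig 4 N (Matrix.specialUnitaryGroup (Fin 3) ℂ) =>
      (diracMatrixAP U mq).det :=
  (continuous_diracMatrixAP mq).matrix_det

/-- **The `N_f`-flavour antiperiodic fermion determinant of the assembled field is the trace of
the slice data.**  For the four-torus field assembled from spatial slices `Us t` and temporal links
`gs t`, `det D^{AP}(U) = Tr ∏_{i<N} T̂_F(Us i) Γ(G_{gs i})` over the `N_f`-flavour slice Fock space
(the `N_f`-flavour antiperiodic capstone B read through the slicing dictionary).
[cite: MontvayMunster1994, §4.1.3 (4.34), §5.1] [cite: Luscher1977, pp. 283–292]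
[cite: Smit2023, §6.5 (6.87)–(6.91)] -/
theorem det_diracMatrixAP_timeAssemble (Nf N : ℕ) [NeZero N]
    (Us : ZMod N → GaugeConfig 3 N (Matrix.specialUnitaryGroup (Fin 3) ℂ))
    (gs : ZMod N → TorusSite 3 N → Matrix.specialUnitaryGroup (Fin 3) ℂ) (mq : Fin Nf → ℝ)
    (hm : ∀ f, -1 < mq f) :
    (diracMatrixAP
        (fun e : Edge 4 N =>
          (Fin.cons (gs (e.1 0) (Fin.tail e.1)) (fun i : Fin 3 => Us (e.1 0) (Fin.tail e.1, i)) :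
            Fin 4 → Matrix.specialUnitaryGroup (Fin 3) ℂ) e.2) mq).det =
      (((List.range N).map fun i : ℕ =>
          fermionSliceOp (Us (i : ZMod N)) mq *
            fockGaugeAct (Nf := Nf) (gs (i : ZMod N))).prod).trace := by
  rw [det_diracMatrixAP_eq_trace_fermionSliceOp Nf N _ mq hm]
  simp only [Fin.cons_succ, Fin.cons_zero, Fin.tail_cons, Prod.mk.eta]

/-- **Pointwise identity behind the `N_f`-flavour thermal capstone C.**  At the field assembled
from `p = (Us, gs)` the `N_f`-flavour thermal QCD Boltzmann integrand `e^{−β S_W(U)} det D^{AP}(U)`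
is the cyclic kernel product times the trace of the time-ordered product of projected fermionic
transfer operators, `(∏_t K_β(Us t, (Us (t+1))^{gs t})) · Tr ∏_{i<N} T̂_F(Us i) Γ(G_{gs i})`.
[cite: MontvayMunster1994, §4.1.3 (4.34), §5.1] [cite: Luscher1977, pp. 283–292]
[cite: Smit2023, §4.6 (4.127)–(4.137), §6.5 (6.87)–(6.91)] -/
theorem integrand_timeAssemble (Nf N : ℕ) [NeZero N] (β : ℝ) (mq : Fin Nf → ℝ)
    (hm : ∀ f, -1 < mq f)
    (p : (ZMod N → GaugeConfig 3 N (Matrix.specialUnitaryGroup (Fin 3) ℂ)) ×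
      (ZMod N → TorusSite 3 N → Matrix.specialUnitaryGroup (Fin 3) ℂ)) :
    (Real.exp (-(β * wilsonAction (fundamentalRep (Fin 3))
        (fun e : Edge 4 N =>
          (Fin.cons (p.2 (e.1 0) (Fin.tail e.1)) (fun i : Fin 3 => p.1 (e.1 0) (Fin.tail e.1, i)) :
            Fin 4 → Matrix.specialUnitaryGroup (Fin 3) ℂ) e.2))) : ℂ) *
        (diracMatrixAP
          (fun e : Edge 4 N =>
            (Fin.cons (p.2 (e.1 0) (Fin.tail e.1)) (fun i : Fin 3 => p.1 (e.1 0) (Fin.tail e.1, i)) :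
              Fin 4 → Matrix.specialUnitaryGroup (Fin 3) ℂ) e.2) mq).det =
      ((∏ t : ZMod N, gaugeSliceKernel β (p.1 t) (gaugeTransform (p.2 t) (p.1 (t + 1))) : ℝ) : ℂ) *
        (((List.range N).map fun i : ℕ =>
            fermionSliceOp (p.1 (i : ZMod N)) mq *
              fockGaugeAct (Nf := Nf) (p.2 (i : ZMod N))).prod).trace := by
  rw [CyclicSupertrace.exp_wilsonAction_timeAssemble N β p.1 p.2,
    det_diracMatrixAP_timeAssemble Nf N p.1 p.2 mq hm]

/-- The `N_f`-flavour thermal QCD Boltzmann integrand `U ↦ e^{−β S_W(U)} det D^{AP}(U)` is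
continuous on the compact configuration space `SU(3)^{edges}` (the Wilson action and the
flavour-diagonal antiperiodic Wilson–Dirac matrix are continuous in the links). [folklore] -/
theorem continuous_integrand (Nf N : ℕ) [NeZero N] (β : ℝ) (mq : Fin Nf → ℝ) :
    Continuous fun U : GaugeConfig 4 N (Matrix.specialUnitaryGroup (Fin 3) ℂ) =>
      (Real.exp (-(β * wilsonAction (fundamentalRep (Fin 3)) U)) : ℂ) *
        (diracMatrixAP U mq).det :=
  (Complex.continuous_ofReal.comp (Real.continuous_exp.comp
    (((Literature.MathematicalPhysics.QuantumFieldTheory.continuous_wilsonAction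
      (fundamentalRep (Fin 3)) (continuous_fundamentalRep (Fin 3))).const_mul β).neg))).mul
    (continuous_det_diracMatrixAP (N := N) mq)

end CyclicTraceAPFlavour

/-- **The `N_f`-flavour thermal capstone C of the F3 dictionary (stub
`qcd_boltzmannAP_integral_eq_cyclic_trace_flavour` of line `Sketch`): the thermal lattice-QCD
Boltzmann integral is a cyclic kernel trace.**  For `N_f` flavours of `r = 1` Wilson quarks of bare
masses `m_f > −1` (fundamental representation of `SU(3)`) on the four-torus `(ℤ/N)⁴` with
time-ANTIPERIODIC boundary condition, `D^{AP}(U) = diracMatrixAP U mq` the flavour-diagonal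
antiperiodic Wilson–Dirac matrix,
`∫ e^{−β S_W(U)} det D^{AP}(U) dU = ∫∫ ∏_t K_β(Us t, (Us (t+1))^{gs t}) · Tr ∏_t T̂_F(Us t) Γ(G_{gs t}) dUs dgs`:
the honest `Z_AP = Tr (𝕋 P̂₀)^N` at kernel level over the `N_f`-flavour slice Fock space, without
gauge fixing — the Haar integrals over the temporal links `gs t` are the Gauss-law projections `P̂₀`.
[cite: MontvayMunster1994, §4.1.3 (4.34), §5.1] [cite: Luscher1977, pp. 283–292]
[cite: OsterwalderSeiler1978, §2] [cite: Smit2023, §4.6 (4.127)–(4.137), §6.5 (6.87)–(6.91)] -/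
theorem qcd_boltzmannAP_integral_eq_cyclic_trace_flavour : ∀ (Nf N : ℕ) [NeZero N] (β : ℝ) (mq : Fin Nf → ℝ), (∀ f, -1 < mq f) → ∫ U : GaugeConfig 4 N (Matrix.specialUnitaryGroup (Fin 3) ℂ), (Real.exp (-(β * wilsonAction (fundamentalRep (Fin 3)) U)) : ℂ) * (diracMatrixAP U mq).det ∂(Measure.pi fun _ : Edge 4 N => haarProbability (Matrix.specialUnitaryGroup (Fin 3) ℂ)) = ∫ p : (ZMod N → GaugeConfig 3 N (Matrix.specialUnitaryGroup (Fin 3) ℂ)) × (ZMod N → TorusSite 3 N → Matrix.specialUnitaryGroup (Fin 3) ℂ), ((∏ t : ZMod N, gaugeSliceKernel β (p.1 t) (gaugeTransform (p.2 t) (p.1 (t + 1))) : ℝ) : ℂ) * (((List.range N).map fun i : ℕ => fermionSliceOp (p.1 (i : ZMod N)) mq * fockGaugeAct (Nf := Nf) (p.2 (i : ZMod N))).prod).trace ∂((Measure.pi fun _ : ZMod N => Measure.pi fun _ : Edge 3 N => haarProbability (Matrix.specialUnitaryGroup (Fin 3) ℂ)).prod (Measure.pi fun _ : ZMod N => Measure.pi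 fun _ : TorusSite 3 N => haarProbability (Matrix.specialUnitaryGroup (Fin 3) ℂ))) := by
  intro Nf N _ β mq hm
  -- T1: the assembling map `(Us, gs) ↦ U` is measure preserving (slice Haar ↦ torus Haar)
  obtain ⟨hasm, -⟩ :=
    Summit.QuantumFields.YangMills.Theorems.WeakCouplingHypercubicLimit.TraceNormColdPressure.stub_timeSlicing
      N (Matrix.specialUnitaryGroup (Fin 3) ℂ) (fundamentalRep (Fin 3))
  -- transport the torus integral along the assembling map
  rw [← hasm.map_eq, integral_map hasm.measurable.aemeasurable
    (CyclicTraceAPFlavour.continuous_integrand Nf N β mq).aestronglyMeasurable]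
  -- and identify the integrands pointwise
  exact integral_congr_ae (ae_of_all _ fun p =>
    CyclicTraceAPFlavour.integrand_timeAssemble Nf N β mq hm p)

end Summit.QuantumFields.QCD.Cruxes.StableActionBridge.Sketch

end
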